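import Literature.Probability.Distributions.GaussianHermiteChaos
import HarnessLib

/-!
# Coordinate moments of the standard Gaussian up to order four (Wick's theorem via Fischer calculus)

For an orthonormal basis `b` of the finite-dimensional real inner product space `E` with its
standard Gaussian measure `γ`, write `xⱼ = ⟪bⱼ, x⟫`. Using the Wiener–Hermite isometry
`∫ (𝓗_b p)(𝓗_b q) dγ = ⟨p, q⟩_F` (`GaussianHermiteChaos`) and the observations
`xⱼ = 𝓗_b(Xⱼ)`, `xⱼ xₖ = 𝓗_b(Xⱼ Xₖ) + δⱼₖ` (`He₁ = X`, `He₂ = X² - 1`), all moments up to order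
four follow from the Fischer calculus without case analysis:

* `integral_coord_stdGaussian` : `∫ xⱼ dγ = 0`;
* `integral_coord_mul_coord_stdGaussian` : `∫ xⱼ xₖ dγ = δⱼₖ`;
* `integral_coord_four_stdGaussian` (**Isserlis / Wick**):
  `∫ xⱼ xₖ xₗ xₘ dγ = δⱼₖ δₗₘ + δⱼₗ δₖₘ + δⱼₘ δₖₗ`, from
  `⟨Xⱼ Xₖ, Xₗ Xₘ⟩_F = ⟨Xₖ, ∂ⱼ(Xₗ Xₘ)⟩_F`;
* the expectations of quadratic and quartic forms (`integral_quadForm_stdGaussian`,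
  `integral_quartForm_stdGaussian`) and the norm moments `∫ ‖x‖² dγ = d`, `∫ ‖x‖⁴ dγ = d (d + 2)`.

## References
* S. Janson, *Gaussian Hilbert Spaces* (1997), Theorem 1.28 (Wick's/Isserlis' theorem) and
  Theorem 3.21.
* L. Isserlis, *On a formula for the product-moment coefficient of any order of a normal
  frequency distribution in any number of variables*, Biometrika 12 (1918) 134–139.
-/

open MeasureTheory ProbabilityTheory Polynomial Finset
open scoped InnerProductSpace Nat

namespace Literature.Probability.Distributions

open Literature.Algebra.Polynomial

noncomputable section

variable {E : Type*} [NormedAddCommGroup E] [InnerProductSpace ℝ E]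
variable {ι : Type*} [Fintype ι] [DecidableEq ι]

/-! ### Coordinates as Wick polynomials -/

omit [DecidableEq ι] in
/-- `He₁ = X`. [folklore] -/
theorem hermiteR_one : hermiteR 1 = Polynomial.X := by
  simp [hermiteR]

omit [DecidableEq ι] in
/-- `He₂ = X² - 1`. [folklore] -/
theorem hermiteR_two : hermiteR 2 = Polynomial.X ^ 2 - 1 := by
  rw [hermiteR_succ, hermiteR_one, Polynomial.derivative_X, sq]

/-- `H_{eⱼ}(v) = ⟪bⱼ, v⟫`. [folklore] -/
theorem hermiteProd_single_one (b : OrthonormalBasis ι ℝ E) (j : ι) (v : E) :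
    hermiteProd b (Finsupp.single j 1) v = ⟪b j, v⟫_ℝ := by
  unfold hermiteProd
  rw [← Finset.mul_prod_erase Finset.univ _ (Finset.mem_univ j)]
  have h : ∀ i ∈ Finset.univ.erase j,
      (hermiteR ((Finsupp.single j 1 : ι →₀ ℕ) i)).eval ⟪b i, v⟫_ℝ = 1 := by
    intro i hi
    simp [Ne.symm (Finset.ne_of_mem_erase hi)]
  rw [Finset.prod_congr rfl h, Finset.prod_const_one, mul_one, Finsupp.single_eq_same,
    hermiteR_one, eval_X]

/-- `xⱼ = 𝓗_b(Xⱼ)(v)`. [folklore] -/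
theorem coord_eq_hermiteEval_X (b : OrthonormalBasis ι ℝ E) (j : ι) (v : E) :
    ⟪b j, v⟫_ℝ = hermiteEval b (MvPolynomial.X j) v := by
  rw [show (MvPolynomial.X j : MvPolynomial ι ℝ) = MvPolynomial.monomial (Finsupp.single j 1) 1
    from rfl, hermiteEval_monomial, one_mul, hermiteProd_single_one]

/-- `H_{eⱼ+eₖ}(v) = xⱼ xₖ - δⱼₖ`. [folklore] -/
theorem hermiteProd_single_add_single (b : OrthonormalBasis ι ℝ E) (j k : ι) (v : E) :
    hermiteProd b (Finsupp.single j 1 + Finsupp.single k 1) v =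
      ⟪b j, v⟫_ℝ * ⟪b k, v⟫_ℝ - if j = k then 1 else 0 := by
  by_cases hjk : j = k
  · subst hjk
    rw [if_pos rfl, ← Finsupp.single_add, show (1 : ℕ) + 1 = 2 from rfl]
    unfold hermiteProd
    rw [← Finset.mul_prod_erase Finset.univ _ (Finset.mem_univ j)]
    have h : ∀ i ∈ Finset.univ.erase j,
        (hermiteR ((Finsupp.single j 2 : ι →₀ ℕ) i)).eval ⟪b i, v⟫_ℝ = 1 := by
      intro i hi
      simp [Ne.symm (Finset.ne_of_mem_erase hi)]
    rw [Finset.prod_congr rfl h, Finset.prod_const_one, mul_one, Finsupp.single_eq_same,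
      hermiteR_two]
    simp [sq]
  · rw [if_neg hjk, sub_zero]
    unfold hermiteProd
    rw [← Finset.mul_prod_erase Finset.univ _ (Finset.mem_univ j),
      ← Finset.mul_prod_erase (Finset.univ.erase j) _ (Finset.mem_erase.2 ⟨Ne.symm hjk, Finset.mem_univ k⟩)]
    have h : ∀ i ∈ (Finset.univ.erase j).erase k,
        (hermiteR ((Finsupp.single j 1 + Finsupp.single k 1 : ι →₀ ℕ) i)).eval ⟪b i, v⟫_ℝ = 1 := by
      intro i hi
      have hik : i ≠ k := Finset.ne_of_mem_erase hi
      have hij : i ≠ j := Finset.ne_of_mem_erase (Finset.mem_of_mem_erase hi)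
      simp [Ne.symm hij, Ne.symm hik]
    rw [Finset.prod_congr rfl h, Finset.prod_const_one, mul_one]
    simp [hjk, Ne.symm hjk, hermiteR_one]

/-- `xⱼ xₖ = 𝓗_b(Xⱼ Xₖ)(v) + δⱼₖ` (`He₂ = X² - 1`). [folklore] -/
theorem coord_mul_coord_eq_hermiteEval (b : OrthonormalBasis ι ℝ E) (j k : ι) (v : E) :
    ⟪b j, v⟫_ℝ * ⟪b k, v⟫_ℝ =
      hermiteEval b (MvPolynomial.X j * MvPolynomial.X k) v + if j = k then 1 else 0 := by
  rw [show (MvPolynomial.X j * MvPolynomial.X k : MvPolynomial ι ℝ) =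
      MvPolynomial.monomial (Finsupp.single j 1 + Finsupp.single k 1) 1 by
    rw [MvPolynomial.X, MvPolynomial.X, MvPolynomial.monomial_mul, one_mul],
    hermiteEval_monomial, one_mul, hermiteProd_single_add_single]
  ring

/-! ### Moments -/

section Gaussian

variable [FiniteDimensional ℝ E] [MeasurableSpace E] [BorelSpace E]

/-- `∫ 𝓗_b p dγ = p₀` (the constant coefficient). [cite: Janson1997, Thm 3.21] -/
theorem integral_hermiteEval (b : OrthonormalBasis ι ℝ E) (p : MvPolynomial ι ℝ) :
    ∫ v, hermiteEval b p v ∂stdGaussian E = MvPolynomial.coeff 0 p := by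
  have h := integral_hermiteEval_mul_hermiteProd b p 0
  simp only [hermiteProd_zero, mul_one] at h
  rw [h]
  simp [mfactorial]

/-- First moments vanish: `∫ xⱼ dγ = 0`. [folklore] -/
theorem integral_coord_stdGaussian (b : OrthonormalBasis ι ℝ E) (j : ι) :
    ∫ v, ⟪b j, v⟫_ℝ ∂stdGaussian E = 0 := by
  simp_rw [coord_eq_hermiteEval_X b j]
  rw [integral_hermiteEval]
  simp

/-- Coordinates are integrable. [folklore] -/
theorem integrable_coord_stdGaussian (b : OrthonormalBasis ι ℝ E) (j : ι) :
    Integrable (fun v => ⟪b j, v⟫_ℝ) (stdGaussian E) := by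
  simp_rw [coord_eq_hermiteEval_X b j]
  exact integrable_hermiteEval b _

/-- Second moments: `∫ xⱼ xₖ dγ = δⱼₖ` (covariance `= id`). [folklore] -/
theorem integral_coord_mul_coord_stdGaussian (b : OrthonormalBasis ι ℝ E) (j k : ι) :
    ∫ v, ⟪b j, v⟫_ℝ * ⟪b k, v⟫_ℝ ∂stdGaussian E = if j = k then 1 else 0 := by
  simp_rw [coord_mul_coord_eq_hermiteEval b j k]
  rw [integral_add (integrable_hermiteEval b _) (integrable_const _), integral_hermiteEval,
    integral_const]
  simp [MvPolynomial.coeff_X_mul']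

/-- Products of two coordinates are integrable. [folklore] -/
theorem integrable_coord_mul_coord_stdGaussian (b : OrthonormalBasis ι ℝ E) (j k : ι) :
    Integrable (fun v => ⟪b j, v⟫_ℝ * ⟪b k, v⟫_ℝ) (stdGaussian E) := by
  simp_rw [coord_mul_coord_eq_hermiteEval b j k]
  exact (integrable_hermiteEval b _).add (integrable_const _)

/-- Products of four coordinates are integrable. [folklore] -/
theorem integrable_coord_four_stdGaussian (b : OrthonormalBasis ι ℝ E) (j k l m : ι) :
    Integrable (fun v => ⟪b j, v⟫_ℝ * ⟪b k, v⟫_ℝ * ⟪b l, v⟫_ℝ * ⟪b m, v⟫_ℝ) (stdGaussian E) := by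
  have h : ∀ v : E, ⟪b j, v⟫_ℝ * ⟪b k, v⟫_ℝ * ⟪b l, v⟫_ℝ * ⟪b m, v⟫_ℝ =
      (hermiteEval b (MvPolynomial.X j * MvPolynomial.X k) v + if j = k then 1 else 0) *
        (hermiteEval b (MvPolynomial.X l * MvPolynomial.X m) v + if l = m then 1 else 0) := by
    intro v
    rw [← coord_mul_coord_eq_hermiteEval, ← coord_mul_coord_eq_hermiteEval]
    ring
  simp_rw [h, add_mul, mul_add]
  refine ((integrable_hermiteEval_mul b _ _).add ((integrable_hermiteEval b _).mul_const _)).add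
    ((Integrable.const_mul (integrable_hermiteEval b _) _).add (integrable_const _))

/-- `(eₐ)! = 1`. [folklore] -/
theorem mfactorial_single_one (a : ι) : mfactorial (Finsupp.single a 1 : ι →₀ ℕ) = 1 := by
  unfold mfactorial
  refine Finset.prod_eq_one fun i _ => ?_
  by_cases h : i = a
  · subst h; simp
  · simp [Ne.symm h]

/-- `⟨Xₐ, X_c⟩_F = δ_{ac}`. [folklore] -/
theorem fischerInner_X_X (a c : ι) :
    fischerInner (MvPolynomial.X a : MvPolynomial ι ℝ) (MvPolynomial.X c) = if a = c then 1 else 0 := by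
  rw [show (MvPolynomial.X a : MvPolynomial ι ℝ) = MvPolynomial.monomial (Finsupp.single a 1) 1
    from rfl, show (MvPolynomial.X c : MvPolynomial ι ℝ) =
    MvPolynomial.monomial (Finsupp.single c 1) 1 from rfl, fischerInner_monomial]
  by_cases hac : a = c
  · subst hac
    rw [if_pos rfl, if_pos rfl, mfactorial_single_one]
    ring
  · rw [if_neg, if_neg hac]
    intro h
    exact hac (Finsupp.single_left_injective one_ne_zero h)

/-- The Fischer product of two quadratic monomials: `⟨Xⱼ Xₖ, Xₗ Xₘ⟩_F = δⱼₗ δₖₘ + δⱼₘ δₖₗ`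
(adjointness `⟨Xⱼ p, q⟩ = ⟨p, ∂ⱼ q⟩` and `⟨Xₖ, Xₙ⟩ = δₖₙ`). [folklore] -/
theorem fischerInner_X_mul_X (j k l m : ι) :
    fischerInner (MvPolynomial.X j * MvPolynomial.X k : MvPolynomial ι ℝ)
      (MvPolynomial.X l * MvPolynomial.X m) =
      (if j = l then 1 else 0) * (if k = m then 1 else 0) +
        (if j = m then 1 else 0) * (if k = l then 1 else 0) := by
  have hX : ∀ i a : ι, MvPolynomial.pderiv i (MvPolynomial.X a : MvPolynomial ι ℝ) =
      if a = i then 1 else 0 := fun i a => by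
    by_cases h : a = i
    · subst h; simp
    · rw [if_neg h, MvPolynomial.pderiv_X_of_ne h]
  rw [← fischerInner_pderiv_right, MvPolynomial.pderiv_mul, fischerInner_add_right, hX, hX]
  by_cases hlj : l = j
  · by_cases hmj : m = j
    · rw [if_pos hlj, if_pos hmj, one_mul, mul_one, fischerInner_X_X, fischerInner_X_X]
      grind
    · rw [if_pos hlj, if_neg hmj, one_mul, mul_zero, fischerInner_zero_right, fischerInner_X_X]
      grind
  · by_cases hmj : m = j
    · rw [if_neg hlj, if_pos hmj, zero_mul, mul_one, fischerInner_zero_right, fischerInner_X_X]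
      grind
    · rw [if_neg hlj, if_neg hmj, zero_mul, mul_zero, fischerInner_zero_right]
      grind

/-- **Isserlis' theorem (Wick's formula) at order four**:
`∫ xⱼ xₖ xₗ xₘ dγ = δⱼₖ δₗₘ + δⱼₗ δₖₘ + δⱼₘ δₖₗ` (Janson 1997, Thm 1.28; Isserlis 1918), here from
`xⱼ xₖ = 𝓗_b(Xⱼ Xₖ) + δⱼₖ` and the Wiener–Hermite isometry. [cite: Janson1997, Thm 1.28] -/
theorem integral_coord_four_stdGaussian (b : OrthonormalBasis ι ℝ E) (j k l m : ι) :
    ∫ v, ⟪b j, v⟫_ℝ * ⟪b k, v⟫_ℝ * ⟪b l, v⟫_ℝ * ⟪b m, v⟫_ℝ ∂stdGaussian E =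
      (if j = k then 1 else 0) * (if l = m then 1 else 0) +
        (if j = l then 1 else 0) * (if k = m then 1 else 0) +
        (if j = m then 1 else 0) * (if k = l then 1 else 0) := by
  set P := (MvPolynomial.X j * MvPolynomial.X k : MvPolynomial ι ℝ)
  set Q := (MvPolynomial.X l * MvPolynomial.X m : MvPolynomial ι ℝ)
  set δ₁ : ℝ := if j = k then 1 else 0
  set δ₂ : ℝ := if l = m then 1 else 0
  have h : ∀ v : E, ⟪b j, v⟫_ℝ * ⟪b k, v⟫_ℝ * ⟪b l, v⟫_ℝ * ⟪b m, v⟫_ℝ =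
      hermiteEval b P v * hermiteEval b Q v + hermiteEval b P v * δ₂ + δ₁ * hermiteEval b Q v +
        δ₁ * δ₂ := by
    intro v
    rw [mul_assoc (⟪b j, v⟫_ℝ * ⟪b k, v⟫_ℝ), coord_mul_coord_eq_hermiteEval b j k v,
      coord_mul_coord_eq_hermiteEval b l m v]
    ring
  simp_rw [h]
  have iA : Integrable (fun v => hermiteEval b P v * hermiteEval b Q v) (stdGaussian E) :=
    integrable_hermiteEval_mul b P Q
  have iB : Integrable (fun v => hermiteEval b P v * δ₂) (stdGaussian E) :=
    (integrable_hermiteEval b P).mul_const δ₂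
  have iC : Integrable (fun v => δ₁ * hermiteEval b Q v) (stdGaussian E) :=
    (integrable_hermiteEval b Q).const_mul δ₁
  have iD : Integrable (fun _ : E => δ₁ * δ₂) (stdGaussian E) := integrable_const _
  rw [integral_add (f := fun v => hermiteEval b P v * hermiteEval b Q v + hermiteEval b P v * δ₂ +
      δ₁ * hermiteEval b Q v) (g := fun _ => δ₁ * δ₂) ((iA.add iB).add iC) iD,
    integral_add (f := fun v => hermiteEval b P v * hermiteEval b Q v + hermiteEval b P v * δ₂)
      (g := fun v => δ₁ * hermiteEval b Q v) (iA.add iB) iC,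
    integral_add iA iB, integral_hermiteEval_mul_hermiteEval, integral_mul_const, integral_const_mul,
    integral_hermiteEval, integral_hermiteEval, integral_const, fischerInner_X_mul_X]
  simp only [P, Q, δ₁, δ₂, MvPolynomial.coeff_X_mul', probReal_univ, smul_eq_mul, one_mul]
  grind

/-! ### Quadratic and quartic forms, norm moments -/

/-- **Expectation of a quadratic form**: `∫ Σⱼₖ xⱼ xₖ cⱼₖ dγ = Σⱼ cⱼⱼ`. [folklore] -/
theorem integral_quadForm_stdGaussian (b : OrthonormalBasis ι ℝ E) (c : ι → ι → ℝ) :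
    ∫ v, ∑ j, ∑ k, ⟪b j, v⟫_ℝ * ⟪b k, v⟫_ℝ * c j k ∂stdGaussian E = ∑ j, c j j := by
  rw [integral_finsetSum _ fun j _ => integrable_finsetSum _ fun k _ =>
    (integrable_coord_mul_coord_stdGaussian b j k).mul_const _]
  simp_rw [integral_finsetSum _ fun k _ => (integrable_coord_mul_coord_stdGaussian b _ k).mul_const _,
    integral_mul_const, integral_coord_mul_coord_stdGaussian, ite_mul, one_mul, zero_mul,
    Finset.sum_ite_eq, Finset.mem_univ, if_true]

/-- `Σ_{jklm} δⱼₖ δₗₘ Fⱼₖₗₘ = Σ_{jl} Fⱼⱼₗₗ`. [folklore] -/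
theorem sum_four_delta_fst (F : ι → ι → ι → ι → ℝ) :
    ∑ j, ∑ k, ∑ l, ∑ m, (if j = k then (1 : ℝ) else 0) * (if l = m then 1 else 0) * F j k l m =
      ∑ j, ∑ l, F j j l l := by
  refine Finset.sum_congr rfl fun j _ => ?_
  rw [Finset.sum_eq_single j]
  · simp only [if_true, one_mul]
    refine Finset.sum_congr rfl fun l _ => ?_
    rw [Finset.sum_eq_single l]
    · simp
    · intro m _ hm; simp [Ne.symm hm]
    · simp
  · intro k _ hk; simp [Ne.symm hk]
  · simp

/-- `Σ_{jklm} δⱼₗ δₖₘ Fⱼₖₗₘ = Σ_{jk} Fⱼₖⱼₖ`. [folklore] -/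
theorem sum_four_delta_snd (F : ι → ι → ι → ι → ℝ) :
    ∑ j, ∑ k, ∑ l, ∑ m, (if j = l then (1 : ℝ) else 0) * (if k = m then 1 else 0) * F j k l m =
      ∑ j, ∑ k, F j k j k := by
  refine Finset.sum_congr rfl fun j _ => Finset.sum_congr rfl fun k _ => ?_
  rw [Finset.sum_eq_single j]
  · simp only [if_true, one_mul]
    rw [Finset.sum_eq_single k]
    · simp
    · intro m _ hm; simp [Ne.symm hm]
    · simp
  · intro l _ hl; simp [Ne.symm hl]
  · simp

/-- `Σ_{jklm} δⱼₘ δₖₗ Fⱼₖₗₘ = Σ_{jk} Fⱼₖₖⱼ`. [folklore] -/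
theorem sum_four_delta_trd (F : ι → ι → ι → ι → ℝ) :
    ∑ j, ∑ k, ∑ l, ∑ m, (if j = m then (1 : ℝ) else 0) * (if k = l then 1 else 0) * F j k l m =
      ∑ j, ∑ k, F j k k j := by
  refine Finset.sum_congr rfl fun j _ => Finset.sum_congr rfl fun k _ => ?_
  rw [Finset.sum_eq_single k]
  · simp only [if_true, mul_one]
    rw [Finset.sum_eq_single j]
    · simp
    · intro m _ hm; simp [Ne.symm hm]
    · simp
  · intro l _ hl; simp [Ne.symm hl]
  · simp

/-- **Expectation of a quartic form** (Isserlis):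
`∫ Σⱼₖₗₘ xⱼxₖxₗxₘ Fⱼₖₗₘ dγ = Σⱼₗ Fⱼⱼₗₗ + Σⱼₖ Fⱼₖⱼₖ + Σⱼₖ Fⱼₖₖⱼ`. [cite: Janson1997, Thm 1.28] -/
theorem integral_quartForm_stdGaussian (b : OrthonormalBasis ι ℝ E) (F : ι → ι → ι → ι → ℝ) :
    ∫ v, ∑ j, ∑ k, ∑ l, ∑ m, ⟪b j, v⟫_ℝ * ⟪b k, v⟫_ℝ * ⟪b l, v⟫_ℝ * ⟪b m, v⟫_ℝ * F j k l m
        ∂stdGaussian E =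
      (∑ j, ∑ l, F j j l l) + (∑ j, ∑ k, F j k j k) + ∑ j, ∑ k, F j k k j := by
  have hI : ∀ j k l m, Integrable (fun v => ⟪b j, v⟫_ℝ * ⟪b k, v⟫_ℝ * ⟪b l, v⟫_ℝ * ⟪b m, v⟫_ℝ *
      F j k l m) (stdGaussian E) := fun j k l m => (integrable_coord_four_stdGaussian b j k l m).mul_const _
  rw [integral_finsetSum _ fun j _ => integrable_finsetSum _ fun k _ =>
    integrable_finsetSum _ fun l _ => integrable_finsetSum _ fun m _ => hI j k l m]
  have h3 : ∀ j k l, ∫ v, ∑ m, ⟪b j, v⟫_ℝ * ⟪b k, v⟫_ℝ * ⟪b l, v⟫_ℝ * ⟪b m, v⟫_ℝ * F j k l m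
      ∂stdGaussian E = ∑ m, ((if j = k then 1 else 0) * (if l = m then 1 else 0) +
        (if j = l then 1 else 0) * (if k = m then 1 else 0) +
        (if j = m then 1 else 0) * (if k = l then 1 else 0)) * F j k l m := by
    intro j k l
    rw [integral_finsetSum _ fun m _ => hI j k l m]
    refine Finset.sum_congr rfl fun m _ => ?_
    rw [integral_mul_const, integral_coord_four_stdGaussian]
  have h2 : ∀ j k, ∫ v, ∑ l, ∑ m, ⟪b j, v⟫_ℝ * ⟪b k, v⟫_ℝ * ⟪b l, v⟫_ℝ * ⟪b m, v⟫_ℝ * F j k l m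
      ∂stdGaussian E = ∑ l, ∑ m, ((if j = k then 1 else 0) * (if l = m then 1 else 0) +
        (if j = l then 1 else 0) * (if k = m then 1 else 0) +
        (if j = m then 1 else 0) * (if k = l then 1 else 0)) * F j k l m := by
    intro j k
    rw [integral_finsetSum _ fun l _ => integrable_finsetSum _ fun m _ => hI j k l m]
    exact Finset.sum_congr rfl fun l _ => h3 j k l
  have h1 : ∀ j, ∫ v, ∑ k, ∑ l, ∑ m, ⟪b j, v⟫_ℝ * ⟪b k, v⟫_ℝ * ⟪b l, v⟫_ℝ * ⟪b m, v⟫_ℝ * F j k l m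
      ∂stdGaussian E = ∑ k, ∑ l, ∑ m, ((if j = k then 1 else 0) * (if l = m then 1 else 0) +
        (if j = l then 1 else 0) * (if k = m then 1 else 0) +
        (if j = m then 1 else 0) * (if k = l then 1 else 0)) * F j k l m := by
    intro j
    rw [integral_finsetSum _ fun k _ => integrable_finsetSum _ fun l _ =>
      integrable_finsetSum _ fun m _ => hI j k l m]
    exact Finset.sum_congr rfl fun k _ => h2 j k
  simp_rw [h1, add_mul, Finset.sum_add_distrib]
  rw [sum_four_delta_fst, sum_four_delta_snd, sum_four_delta_trd]

omit [DecidableEq ι] [FiniteDimensional ℝ E] [MeasurableSpace E] [BorelSpace E] in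
/-- `‖v‖² = Σⱼ xⱼ²`. [folklore] -/
theorem norm_sq_eq_sum_coord_sq (b : OrthonormalBasis ι ℝ E) (v : E) :
    ‖v‖ ^ 2 = ∑ j, ⟪b j, v⟫_ℝ * ⟪b j, v⟫_ℝ := by
  rw [← b.sum_sq_inner_left v]
  simp_rw [sq, real_inner_comm v]

/-- **`∫ ‖x‖² dγ = d`**. [folklore] -/
theorem integral_norm_sq_stdGaussian (b : OrthonormalBasis ι ℝ E) :
    ∫ v, ‖v‖ ^ 2 ∂stdGaussian E = Fintype.card ι := by
  simp_rw [norm_sq_eq_sum_coord_sq b]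
  rw [integral_finsetSum _ fun j _ => integrable_coord_mul_coord_stdGaussian b j j]
  simp_rw [integral_coord_mul_coord_stdGaussian]
  simp

/-- **`∫ ‖x‖⁴ dγ = d (d + 2)`**. [folklore] -/
theorem integral_norm_pow_four_stdGaussian (b : OrthonormalBasis ι ℝ E) :
    ∫ v, ‖v‖ ^ 4 ∂stdGaussian E = Fintype.card ι * (Fintype.card ι + 2) := by
  -- `‖v‖⁴ = Σ_{jklm} xⱼxₖxₗxₘ δⱼₖ δₗₘ`
  have h : ∀ v : E, ‖v‖ ^ 4 = ∑ j, ∑ k, ∑ l, ∑ m,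
      ⟪b j, v⟫_ℝ * ⟪b k, v⟫_ℝ * ⟪b l, v⟫_ℝ * ⟪b m, v⟫_ℝ *
        ((if j = k then (1 : ℝ) else 0) * (if l = m then 1 else 0)) := by
    intro v
    have e : ∀ j k l m : ι, ⟪b j, v⟫_ℝ * ⟪b k, v⟫_ℝ * ⟪b l, v⟫_ℝ * ⟪b m, v⟫_ℝ *
        ((if j = k then (1 : ℝ) else 0) * (if l = m then 1 else 0)) =
        (if j = k then (1 : ℝ) else 0) * (if l = m then 1 else 0) *
          (⟪b j, v⟫_ℝ * ⟪b k, v⟫_ℝ * ⟪b l, v⟫_ℝ * ⟪b m, v⟫_ℝ) := fun j k l m => by ring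
    simp_rw [e]
    rw [sum_four_delta_fst, show (4 : ℕ) = 2 * 2 from rfl, pow_mul, norm_sq_eq_sum_coord_sq b, sq,
      Finset.sum_mul_sum]
    refine Finset.sum_congr rfl fun j _ => Finset.sum_congr rfl fun l _ => ?_
    ring
  simp_rw [h]
  rw [integral_quartForm_stdGaussian]
  have s1 : ∑ j : ι, ∑ l : ι, ((if j = j then (1 : ℝ) else 0) * if l = l then 1 else 0) =
      Fintype.card ι * Fintype.card ι := by
    simp
  have s2 : ∑ j : ι, ∑ k : ι, ((if j = k then (1 : ℝ) else 0) * if j = k then 1 else 0) =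
      Fintype.card ι := by
    have : ∀ j : ι, ∑ k : ι, ((if j = k then (1 : ℝ) else 0) * if j = k then 1 else 0) = 1 := by
      intro j
      rw [Finset.sum_eq_single j]
      · simp
      · intro k _ hk; simp [Ne.symm hk]
      · simp
    simp_rw [this]
    simp
  have s3 : ∑ j : ι, ∑ k : ι, ((if j = k then (1 : ℝ) else 0) * if k = j then 1 else 0) =
      Fintype.card ι := by
    have : ∀ j : ι, ∑ k : ι, ((if j = k then (1 : ℝ) else 0) * if k = j then 1 else 0) = 1 := by
      intro j
      rw [Finset.sum_eq_single j]
      · simp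
      · intro k _ hk; simp [Ne.symm hk]
      · simp
    simp_rw [this]
    simp
  rw [s1, s2, s3]
  ring

end Gaussian

end

end Literature.Probability.Distributions
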